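import Literature.Geometry.Lorentzian.CoordAdjMomGSBound
import Literature.Geometry.Lorentzian.CoordConstraintCongr
import Literature.Geometry.Lorentzian.CoordAdjointLinear
import HarnessLib

/-!
# Pointwise bookkeeping for the boundary coercivity estimate (Chruściel–Delay 2003, (3.4) at ∂M)

Topic `Literature/Geometry/Lorentzian`, coordinate tensor calculus `MetricCoord`. Everything here is
PROVED; no definition and no statement of `Prop` type is introduced.

Support file for `CoordBoundaryCoercivity.lean` (the estimate (3.4) of Chruściel–Delay 2003 for
fields supported near the boundary, assembled from (5.12), Prop. C.4 and the Hessian estimate):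
the pointwise facts entering the absorption argument, for the rows
`R_K = adjHamK N + adjMomKS Y`, `R_G = adjHamG N + adjMomGS Y` of the KID operator.

* `kidRows_eq_zero_of_eventuallyEq` — where `N` and `Y` vanish identically near a point, both rows,
  `∇Y`, `div Y`, `Hess N`, `dN` vanish at the point (locality of `P*`);
* `cdWeight_exp_eq` — `e^{2(σ/x + 2 log x)} = e^{2σ/x} x⁴`;
* `normSqAt_symAt_covDAt_le_kidT` — `|S(Y)|² ≤ (2 + n²/2)|S(Y) + ½(div Y)G|²`;
* `kidT_weighted_le`, `hessAt_weighted_le`, `adjMomGS_weighted_le` — the weighted pointwise bounds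
  `x⁴|T|² ≤ c_n x⁴|R_K|² + 3x₀w₁N²`, `x⁸|Hess N|² ≤ a_n x⁸|R_G|² + 3x₀z₁N² + a_n x⁸|M|²`,
  `x⁸|M|² ≤ (4+3n)x₀k₁ x⁴|∇Y|² + (1+2n²)x₀k₂|Y|²` on the collar `{0 < x ≤ x₀ ≤ 1}` under the
  bounds `|tr K G + 2K|² ≤ w₁`, `|Z|² ≤ z₁`, `|K|² ≤ k₁`, `|∇K|² ≤ k₂` (condition (5.10) of
  Chruściel–Delay in the compact-collar setting).

## References

* P. T. Chruściel, E. Delay, Mém. Soc. Math. Fr. 94 (2003), §3 (3.4), Thm. 5.9 with (5.10).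
  [ChruscielDelay2003]
-/

noncomputable section

set_option maxSynthPendingDepth 3

open Set Filter Module Function
open scoped Topology ContDiff

namespace Literature.Geometry.Lorentzian

namespace MetricCoord

variable {E : Type*} [NormedAddCommGroup E] [NormedSpace ℝ E] [FiniteDimensional ℝ E]
  [CompleteSpace E] {ι : Type*} [Fintype ι] (b : Basis ι ℝ E)
  {G : E → E →L[ℝ] E →L[ℝ] ℝ} {V : Set E} {x : E} {K : E → E →L[ℝ] E →L[ℝ] ℝ}
  {N : E → ℝ} {Y : E → E}

/-! ### Locality: the rows vanish where `N, Y` vanish identically -/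

omit [CompleteSpace E] [Fintype ι] in
/-- **Where `N ≡ 0` and `Y ≡ 0` near `x`, everything vanishes at `x`**: both rows of the KID
operator, `∇Y`, `div Y`, `Hess N`, `dN`, `N`, `Y`. [cite: ChruscielDelay2003, §2] -/
theorem kidRows_eq_zero_of_eventuallyEq (hN : N =ᶠ[𝓝 x] fun _ ↦ 0) (hY : Y =ᶠ[𝓝 x] fun _ ↦ 0) :
    adjHamK G K N x + adjMomKS G Y x = 0 ∧ adjHamG G K N x + adjMomGS G K Y x = 0 ∧
      covDAt G Y x = 0 ∧ divAt G Y x = 0 ∧ hessAt G N x = 0 ∧ fderiv ℝ N x = 0 ∧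
      N x = 0 ∧ Y x = 0 := by
  have hG : G =ᶠ[𝓝 x] G := EventuallyEq.rfl
  have hKK : K =ᶠ[𝓝 x] K := EventuallyEq.rfl
  have hN0 : N x = 0 := hN.self_of_nhds
  have hY0 : Y x = 0 := hY.self_of_nhds
  have hdN : fderiv ℝ N x = 0 := by rw [hN.fderiv_eq, fderiv_fun_const]; rfl
  have hhess : hessAt G N x = 0 := by
    rw [hessAt_congr_of_eventuallyEq G hN]
    ext v w
    simp [hessAt_apply]
  have hcov : covDAt G Y x = 0 := by
    ext e
    simp only [covDAt_apply, hY0, hY.fderiv_eq, fderiv_fun_const, map_zero, _root_.zero_apply,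
      add_zero, Pi.zero_apply]
  have hdiv : divAt G Y x = 0 := by rw [divAt_eq, hcov, map_zero]
  have h1 : adjHamK G K N x = 0 := by
    rw [adjHamK_congr_of_eventuallyEq hG hKK hN, adjHamK]
    simp
  have h2 : adjMomKS G Y x = 0 := by
    rw [adjMomKS_congr_of_eventuallyEq hG hY]
    exact adjMomKS_zero_field
  have h3 : adjHamG G K N x = 0 := by
    rw [adjHamG_congr_of_eventuallyEq hG hKK hN, adjHamG, adjScalAt, lapAt_const]
    have hh : hessAt G (fun _ : E ↦ (0 : ℝ)) x = 0 := by
      ext v w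
      simp [hessAt_apply]
    simp [hh]
  have h4 : adjMomGS G K Y x = 0 := by
    rw [adjMomGS_congr_of_eventuallyEq hG hKK hY]
    exact adjMomGS_zero_field
  refine ⟨by rw [h1, h2, add_zero], by rw [h3, h4, add_zero], hcov, hdiv, hhess, hdN, hN0, hY0⟩

/-! ### The weight -/

/-- `e^{2(σ/r + 2 log r)} = e^{2σ/r} r⁴` for `r > 0` (so the weight of Prop. C.4 with `s = −σ`,
`t = 2`, and the weight `e^{2u}`, `u = σ/x + 2 log x`, of the weighted Korn inequality, are both
`e^{2σ/x} x⁴`). [folklore] -/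
theorem cdWeight_exp_eq (σ : ℝ) {r : ℝ} (hr : 0 < r) :
    Real.exp (2 * (σ / r + 2 * Real.log r)) = Real.exp (2 * σ / r) * r ^ 4 := by
  rw [mul_add, Real.exp_add, show 2 * (2 * Real.log r) = ((4 : ℕ) : ℝ) * Real.log r by
    push_cast; ring, Real.exp_nat_mul, Real.exp_log hr, mul_div_assoc']

/-! ### `|S(Y)|²` against `|T|²`, `T = S(Y) + ½ (div Y) G` -/

omit [CompleteSpace E] [Fintype ι] in
/-- **`|S(Y)|² ≤ (2 + n²/2) |T|²`** with `T = S(Y) + ½(div Y)G` (`div Y = tr_G T/(1 + n/2)`,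
`(tr_G T)² ≤ n|T|²`), at a positive definite point. [cite: ChruscielDelay2003, Thm. 5.9 (proof)] -/
theorem normSqAt_symAt_covDAt_le_kidT (hG : IsMetricOn G V) (hx : x ∈ V)
    (hpos : ∀ v : E, v ≠ 0 → 0 < G x v v) :
    normSqAt G x (symAt ((G x).comp (covDAt G Y x))) ≤
      (2 + (finrank ℝ E : ℝ) ^ 2 / 2)
        * normSqAt G x (symAt ((G x).comp (covDAt G Y x)) + (2⁻¹ * divAt G Y x) • G x) := by
  have hi := hG.isInvertible x hx
  have hs := hG.symm x hx
  set S := symAt ((G x).comp (covDAt G Y x)) with hS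
  set d := divAt G Y x with hd
  set T := S + (2⁻¹ * d) • G x with hT
  set n : ℝ := (finrank ℝ E : ℝ) with hn
  have hn0 : 0 ≤ n := Nat.cast_nonneg _
  have htrT : mtrAt G x T = d * (1 + n / 2) := by
    rw [hT, mtrAt_add, mtrAt_smul, mtrAt_metric hi hs, hS, mtrAt_symAt hi hs,
      mtrAt_metric_comp_covDAt hi, ← hd, ← hn]
    ring
  have hTsq := mtrAt_sq_le_normSqAt hG hx hpos T
  rw [← hn] at hTsq
  have hT0 := normSqAt_nonneg_of_pos hG hx hpos T
  have hd2 : d ^ 2 ≤ n * normSqAt G x T := by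
    have h1 : d ^ 2 ≤ (d * (1 + n / 2)) ^ 2 := by nlinarith [sq_nonneg d, sq_nonneg (d * n)]
    rw [← htrT] at h1
    exact h1.trans hTsq
  have hSexp : S = T + (-(2⁻¹ * d)) • G x := by rw [hT, neg_smul, add_neg_cancel_right]
  have hadd := normSqAt_add_le hG hx hpos T ((-(2⁻¹ * d)) • G x)
  rw [← hSexp, normSqAt_smul, normSqAt_metric hi hs, ← hn] at hadd
  nlinarith [mul_nonneg hn0 hT0, mul_nonneg (mul_nonneg hn0 hn0) hT0]

/-! ### The weighted pointwise bounds on the collar -/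

omit [CompleteSpace E] [Fintype ι] in
/-- **`e x⁴|T|² ≤ c_n e x⁴|R_K|² + 3 x₀ w₁ e N²`** on `{0 < x, x⁴ ≤ x₀}` under `|tr K G + 2K|² ≤ w₁`
(`c_n = 3 + 3(3/(2(n−1)))²n²`, `e ≥ 0` any weight). [cite: ChruscielDelay2003, Thm. 5.9 (proof)] -/
theorem kidT_weighted_le (hG : IsMetricOn G V) (hx : x ∈ V) (hpos : ∀ v : E, v ≠ 0 → 0 < G x v v)
    (hn : finrank ℝ E ≠ 1) {X e x₀ w₁ : ℝ} (he : 0 ≤ e) (hX : 0 ≤ X ^ 4) (hXx : X ^ 4 ≤ x₀)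
    (hW : normSqAt G x (mtrAt G x (K x) • G x + (2 : ℝ) • K x) ≤ w₁) :
    e * X ^ 4 * normSqAt G x (symAt ((G x).comp (covDAt G Y x)) + (2⁻¹ * divAt G Y x) • G x) ≤
      (3 + 3 * (3 / (2 * ((finrank ℝ E : ℝ) - 1))) ^ 2 * (finrank ℝ E : ℝ) ^ 2)
          * (e * X ^ 4 * normSqAt G x (adjHamK G K N x + adjMomKS G Y x))
        + 3 * (x₀ * w₁) * (e * N x ^ 2) := by
  have h := normSqAt_kidT_le (K := K) (N := N) (Y := Y) hG hx hpos hn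
  have hW0 : 0 ≤ normSqAt G x (mtrAt G x (K x) • G x + (2 : ℝ) • K x) :=
    normSqAt_nonneg_of_pos hG hx hpos _
  have h1 := mul_le_mul_of_nonneg_left h (mul_nonneg he hX)
  have h2 : X ^ 4 * normSqAt G x (mtrAt G x (K x) • G x + (2 : ℝ) • K x) ≤ x₀ * w₁ :=
    mul_le_mul hXx hW hW0 (hX.trans hXx)
  nlinarith [mul_le_mul_of_nonneg_left h2 (mul_nonneg he (sq_nonneg (N x)))]

omit [CompleteSpace E] [Fintype ι] in
/-- **`e x⁸|Hess N|² ≤ a_n e x⁸|R_G|² + 3 x₀ z₁ e N² + a_n e x⁸|M|²`** on `{0 < x, x⁸ ≤ x₀}` under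
`|Z|² ≤ z₁` (`a_n = 6(1 + (n−1)⁻²n²)`, `M = adjMomGS Y`, `Z` as in `kidRowG_recovery`).
[cite: ChruscielDelay2003, Thm. 5.9 (proof)] -/
theorem hessAt_weighted_le (hG : IsMetricOn G V) (hx : x ∈ V) (hpos : ∀ v : E, v ≠ 0 → 0 < G x v v)
    (hn : finrank ℝ E ≠ 1) {X e x₀ z₁ : ℝ} (he : 0 ≤ e) (hX : 0 ≤ X ^ 8) (hXx : X ^ 8 ≤ x₀)
    (hZ : normSqAt G x (ricAt G x - (2 : ℝ) • (K x).comp ((sharpAt G x).comp (K x))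
            + (2 * mtrAt G x (K x)) • K x
            + (((finrank ℝ E : ℝ) - 1)⁻¹ * (-scalAt G x
                + 2 * mtrAt G x ((K x).comp ((sharpAt G x).comp (K x)))
                - 2 * mtrAt G x (K x) ^ 2)) • G x) ≤ z₁) :
    e * X ^ 8 * normSqAt G x (hessAt G N x) ≤
      6 * (1 + (((finrank ℝ E : ℝ) - 1)⁻¹) ^ 2 * (finrank ℝ E : ℝ) ^ 2)
          * (e * X ^ 8 * normSqAt G x (adjHamG G K N x + adjMomGS G K Y x))
        + 3 * (x₀ * z₁) * (e * N x ^ 2)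
        + 6 * (1 + (((finrank ℝ E : ℝ) - 1)⁻¹) ^ 2 * (finrank ℝ E : ℝ) ^ 2)
          * (e * X ^ 8 * normSqAt G x (adjMomGS G K Y x)) := by
  have h := normSqAt_hessAt_le_of_rows (K := K) (N := N) (Y := Y) hG hx hpos hn
  have hZ0 : 0 ≤ normSqAt G x (ricAt G x - (2 : ℝ) • (K x).comp ((sharpAt G x).comp (K x))
      + (2 * mtrAt G x (K x)) • K x
      + (((finrank ℝ E : ℝ) - 1)⁻¹ * (-scalAt G x
          + 2 * mtrAt G x ((K x).comp ((sharpAt G x).comp (K x)))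
          - 2 * mtrAt G x (K x) ^ 2)) • G x) := normSqAt_nonneg_of_pos hG hx hpos _
  have h1 := mul_le_mul_of_nonneg_left h (mul_nonneg he hX)
  have h2 := mul_le_mul hXx hZ hZ0 (hX.trans hXx)
  nlinarith [mul_le_mul_of_nonneg_left h2 (mul_nonneg he (sq_nonneg (N x)))]

/-- **`e x⁸|M|² ≤ (4+3n) x₀ k₁ (e x⁴|∇Y|²) + (1+2n²) x₀ k₂ (e |Y|²)`** on `{0 < x, x⁴ ≤ x₀, x⁸ ≤ x₀}`
under `|K|² ≤ k₁`, `|∇K|² ≤ k₂` (`M = adjMomGS Y`). [cite: ChruscielDelay2003, Thm. 5.9 with (5.10c)] -/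
theorem adjMomGS_weighted_le (hG : IsMetricOn G V) (hx : x ∈ V)
    (hpos : ∀ v : E, v ≠ 0 → 0 < G x v v) (hK : ContDiffOn ℝ ∞ K V)
    (hKs : ∀ y ∈ V, ∀ v w, K y v w = K y w v) (hY : ContDiffOn ℝ ∞ Y V)
    {X e x₀ k₁ k₂ : ℝ} (he : 0 ≤ e) (hX4 : 0 ≤ X ^ 4) (hX4x : X ^ 4 ≤ x₀) (hX8x : X ^ 8 ≤ x₀)
    (hk : normSqAt G x (K x) ≤ k₁)
    (hcov : ∑ k, ∑ l, ginv G b x k l * pairAt G x (cov₂At G K x (b k)) (cov₂At G K x (b l)) ≤ k₂) :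
    e * X ^ 8 * normSqAt G x (adjMomGS G K Y x) ≤
      (4 + 3 * finrank ℝ E) * (x₀ * k₁)
          * (e * X ^ 4 * mtrAt G x ((G x).bilinearComp (covDAt G Y x) (covDAt G Y x)))
        + (1 + 2 * (finrank ℝ E : ℝ) ^ 2) * (x₀ * k₂) * (e * G x (Y x) (Y x)) := by
  have h := hG.normSqAt_adjMomGS_le b hx hpos hK hKs hY
  have hQ0 : 0 ≤ mtrAt G x ((G x).bilinearComp (covDAt G Y x) (covDAt G Y x)) :=
    hG.mtrAt_bilinearComp_nonneg hx hpos _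
  have hK0 : 0 ≤ normSqAt G x (K x) := normSqAt_nonneg_of_pos hG hx hpos _
  have hc0 : 0 ≤ ∑ k, ∑ l, ginv G b x k l * pairAt G x (cov₂At G K x (b k)) (cov₂At G K x (b l)) :=
    hG.covNormSq_nonneg b hx hpos hK hKs
  have hnY0 : 0 ≤ G x (Y x) (Y x) := by
    by_cases hz : Y x = 0
    · simp [hz]
    · exact (hpos _ hz).le
  have hn0 : (0 : ℝ) ≤ finrank ℝ E := Nat.cast_nonneg _
  have hX8 : 0 ≤ X ^ 8 := by nlinarith
  -- `x⁸ |K|² Q = x⁴|K|² · x⁴ Q ≤ x₀ k₁ · x⁴ Q` and `x⁸ |∇K|² |Y|² ≤ x₀ k₂ |Y|²`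
  have h1 : X ^ 8 * (normSqAt G x (K x)
      * mtrAt G x ((G x).bilinearComp (covDAt G Y x) (covDAt G Y x))) ≤
      x₀ * k₁ * (X ^ 4 * mtrAt G x ((G x).bilinearComp (covDAt G Y x) (covDAt G Y x))) := by
    have ha : X ^ 4 * normSqAt G x (K x) ≤ x₀ * k₁ := mul_le_mul hX4x hk hK0 (hX4.trans hX4x)
    have := mul_le_mul_of_nonneg_right ha (mul_nonneg hX4 hQ0)
    nlinarith
  have h2 : X ^ 8 * ((∑ k, ∑ l, ginv G b x k l * pairAt G x (cov₂At G K x (b k)) (cov₂At G K x (b l)))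
      * G x (Y x) (Y x)) ≤ x₀ * k₂ * G x (Y x) (Y x) := by
    have ha := mul_le_mul hX8x hcov hc0 (hX8.trans hX8x)
    have := mul_le_mul_of_nonneg_right ha hnY0
    nlinarith
  have h3 := mul_le_mul_of_nonneg_left h (mul_nonneg he hX8)
  nlinarith [mul_le_mul_of_nonneg_left h1 (mul_nonneg he (by positivity : (0 : ℝ) ≤ 4 + 3 * finrank ℝ E)),
    mul_le_mul_of_nonneg_left h2 (mul_nonneg he (by positivity : (0 : ℝ) ≤ 1 + 2 * (finrank ℝ E : ℝ) ^ 2))]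

end MetricCoord

end Literature.Geometry.Lorentzian

end
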